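import Summits.BirchSwinnertonDyer.Rank1Residual.Partition.AnticyclotomicControlJSW
import HarnessLib

/-!
# Rows C2, C16 and C3 with the anticyclotomic CONTROL link PUBLISHED at every pair (Jetchev–Skinner–
# Wan 2017 Thm. 3.3.1): only the anticyclotomic main conjecture ∘ BDP and (irred_K) remain typed
# (cell `b2b-bsdres`, GLUE seat gen 6; companion of `AnticyclotomicControlJSW.lean` and of gen 5's
# `MainConjecturesControlPublishedClass.lean`)

HONEST FRAMING (cell `b2b-bsdres`, run/shared/lean/b2b/bsd-rank1-residual/, verbatim in every
file): the goal of the cell is to DELETE the COMBINATION-SHAPED residual classes of the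
Birch–Swinnerton-Dyer formula for ALL analytic-rank `≤ 1` elliptic curves over `ℚ` — "full BSD
formula for every rank `≤ 1` curve in class `C`" assembled STRICTLY from published theorems — so
that the rank-`≤ 1` remainder becomes exactly the CONSTRUCTION-SHAPED classes, which are TYPED
(missing-input `Prop`s), NOT attempted. This is not "finishing BSD". Research routes; no claim
beyond the stated classes; nothing booked; no label changes. THEOREMS ONLY (no definition, no named
fact, no `sorry`); every published theorem enters as one of the tree's existing named Literature
facts BY NAME; every unproved / untyped-in-Literature statement enters as an EXPLICIT binder.

## What this file records

Gen 5's row theorems `RowC2.bsdp_of_bcsThm112b_of_thm511` / `RowC3.bsdp_of_thm511_of_columnMainConjectures`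
took the covered irreducible rank-one pairs OFF the anomalous line (`hna : a_p ≢ 1 (mod p)`), because
the control theorem then available as a Literature fact (CGLS 2022 Thm. 5.1.1) assumes
`E(ℚ_p)[p] = 0`. With JSW 2017 Thm. 3.3.1 now a named fact
(`JetchevSkinnerWan2017.thm331_anticyclotomicControl`, p247486) and its adapter
`bsdp_rankOne_of_thm331_of_columnMainConjecture_odd` (`AnticyclotomicControlJSW.lean` §3), the row
theorems are restated WITHOUT `hna`:

* `RowC2.bsdp_of_bcsThm112b_of_thm331` — row C2 (`r ≤ 1`; `p ∤ ∏c_ℓ` in rank one): BCS 2025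
  Thm. 1.1.2 (b) (cyclotomic MC, PUBLISHED) + JSW Thm. 3.3.1 (control, PUBLISHED) + (IMC≥∘BDP)ᵍ
  typed (`hLA`, JSW/Castella convention; BCS Thm. 1.2.4 in print) + (irred_K) `hIrrK` + cited control
  (`hLA`, `hIrrK` asked in rank one);
* `RowC16.bsdp_of_yzThm49_of_thm331` — row C16 (`p = 3`; `r ≤ 1`): Yan–Zhu Thm. 4.9 + JSW 3.3.1 at
  `p = 3` + `hLA` (Yan–Zhu Thm. 4.12 in print) + `hIrrK`;
* `RowC3.bsdp_of_thm331_of_columnMainConjectures` — row C3 at every prime of the row: the ordinary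
  branch at EVERY pair (BCS (b) / Yan–Zhu 4.9 + JSW 3.3.1 + `hLA` + `hIrrK`), the supersingular
  branch as in `RowC3.bsdp_of_mainConjectures_of_onTreeGoodLinks` (typed Kobayashi MC + BKO A.5).

The binder `hIrrK` ((irred_𝒦) at the imaginary quadratic fields with `p` split) is JSW's own
hypothesis; in print it follows from (sur), or from (irr) + (ram) (Skinner 2020 Lemma 2.8.1); it is
not a tree theorem and is carried explicitly.

References: [JetchevSkinnerWan2017] Thm. 1.2.1, Thm. 3.3.1, §3.5 (3.5.d), §7.4.1;
[BurungaleCastellaSkinner2025] Thm. 1.1.2 (b), 1.2.4, Cor. 1.3.1; [YanZhu2024MainConjNonCM] Thm. 4.9,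
4.12, 4.15; [BurungaleKobayashiOta2023] Cor. A.5; [Wuthrich2014] Lemma 20; [Skinner2020] Lemma
2.8.1; [Miller2011LMS] Def. 1.1; HOME/b2b-bsdres-lit-glue/GLUE.md GEN 6 ADDENDUM.
-/

set_option autoImplicit false

noncomputable section

open scoped Classical

open WeierstrassCurve NumberField IsDedekindDomain Literature.NumberTheory.EllipticCurves
  Literature.NumberTheory.EllipticCurves.ModularForms Literature.NumberTheory.Automorphic
  Literature.NumberTheory.EllipticCurves.Rank1Residual
  Literature.NumberTheory.EllipticCurves.YanZhu2026
  Literature.NumberTheory.EllipticCurves.BurungaleCastellaSkinner2025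
  Literature.NumberTheory.EllipticCurves.BurungaleKobayashiOta2024
  Literature.NumberTheory.EllipticCurves.CastellaGrossiLeeSkinner2022
  Literature.NumberTheory.EllipticCurves.JetchevSkinnerWan2017
  Summit.BirchSwinnertonDyer.BirchSwinnertonDyer.Theorems.Rank1ResidualX1Defs

namespace Summit.BirchSwinnertonDyer.Rank1Residual

/-! ### Rows C2, C16 and C3 with the control link published at every pair -/

section Rows

variable {W : WeierstrassCurve ℚ} [W.IsElliptic] [W.IsGloballyMinimal] {p : ℕ} [Fact p.Prime]

/-- **Row C2 (`r ≤ 1`), anomalous or not, with the anticyclotomic control link PUBLISHED.** `¬cm`,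
`p > 3` good ordinary, (irr), (im); `p ∤ ∏c_ℓ` asked in rank one (`htam0`). Rank `0`: BCS 2025
Thm. 1.1.2 (b) + Greenberg 4.1 (gen 2's `RowC2.bsdp_rankZero_of_bcsThm112b`). Rank `1`: BCS (b) for
the twist + JSW 2017 Thm. 3.3.1 (`h331`) + the typed (IMC≥∘BDP)ᵍ `hLA` (BCS Thm. 1.2.4 in print) +
(irred_K) `hIrrK` + cited control (§3). Compared with gen 5's `RowC2.bsdp_of_bcsThm112b_of_thm511`:
no `hna` — the anomalous pairs of the row are served.
[cite: BurungaleCastellaSkinner2025, Thm. 1.1.2 (b), Thm. 1.2.4, Cor. 1.3.1]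
[cite: JetchevSkinnerWan2017, Thm. 3.3.1 with §3.5 (3.5.d)] [cite: Miller2011LMS, Def. 1.1] -/
theorem RowC2.bsdp_of_bcsThm112b_of_thm331
    (hGZ : ∀ (N : ℕ) [NeZero N] (W : WeierstrassCurve ℚ) (K : Type) [Field K] [NumberField K],
      gross_zagier N W K)
    (hKo : ∀ (N : ℕ) [NeZero N] (W : WeierstrassCurve ℚ) (K : Type) [Field K] [NumberField K],
      kolyvagin N W K)
    (hB : ∀ (N : ℕ) [NeZero N] (W : WeierstrassCurve ℚ) (K : Type) [Field K] [NumberField K],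
      Kolyvagin1990_padicValNat_card_sha_le N W K)
    (hBCS : thm112b_charIdeal_eq_padicLFunction_integral) (h331 : thm331_anticyclotomicControl)
    (hGr : greenberg_charValue_rankZero) (hGZK : rank_eq_analyticRank_of_analyticRank_le_one)
    (hmod : hasEntireLFunction_rat) (hpar : nonempty_modularParametrizationData)
    (hnf : exists_isNewformOf) (hHL : HoffsteinLuo1997_exists_twist_L_one_ne_zero)
    (hMaz : mazur_not_dvd_maninConstant_of_odd) (hNS : integral_neronScaling_of_isGloballyMinimal)
    (h : RowC2 W p) (hr : W.analyticRank ≤ 1)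
    (htam0 : W.analyticRank = 1 → ¬ p ∣ W.tamagawaProduct)
    (hIrrK : W.analyticRank = 1 → ∀ (K : Type) [Field K] [NumberField K], IsImaginaryQuadratic K →
      SatisfiesHeegnerHypothesis (W.conductorNorm ℤ) K → SatisfiesHeegnerHypothesis p K →
      (W.baseChange K).HasIrreducibleModPGaloisRep p)
    (hLA : W.analyticRank = 1 → ∀ (N : ℕ) [NeZero N] (K : Type) [Field K] [NumberField K]
      (Dt : ModularParametrizationData W N) (H : HeegnerDatum N (NumberField.discr K)) (ιC : K →+* ℂ)
      (P : (W.baseChange K).toAffine.Point),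
      W.conductorNorm ℤ = N → IsImaginaryQuadratic K → Odd (NumberField.discr K) →
      NumberField.discr K < -4 → SatisfiesHeegnerHypothesis N K → SatisfiesHeegnerHypothesis p K →
      (W.quadraticTwist (NumberField.discr K : ℚ)).entireLFunction 1 ≠ 0 →
      WeierstrassCurve.Affine.Point.map ιC.toRatAlgHom P = heegnerPointComplex Dt H →
      ¬ (p : ℤ) ∣ Dt.c → ¬ IsOfFinAddOrder P →
      ∀ (κ : ZpExtension K p), κ.IsAnticyclotomic →
        ∀ (γ : Field.absoluteGaloisGroup K) [Fact (κ.IsTopGenerator γ)] (ι : K →+* ℚ_[p]),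
          X11b.IMCLowerWaldspurgerOnTreeGoodAt p κ (X11b.inducedPlace ι) γ ι P) :
    BSDp W p := by
  have hp : 3 < p := h.2.1
  have hp5 : 5 ≤ p := (Fact.out : p.Prime).five_le_of_ne_two_of_ne_three (by omega) (by omega)
  rcases Nat.lt_or_ge W.analyticRank 1 with h0 | h1
  · exact RowC2.bsdp_rankZero_of_bcsThm112b hBCS hGr hpar hGZK h (by omega)
  · have hr1 : W.analyticRank = 1 := le_antisymm hr h1
    exact bsdp_rankOne_of_thm331_of_columnMainConjecture_odd hGZ hKo hB h331 hGr hGZK hmod hpar hnf hHL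
      hMaz hNS W p (by omega) h.2.2.1 (surj_of_irr_of_bigIm W p h.2.2.2.1 h.2.2.2.2) hr1 (htam0 hr1)
      (fun V _ _ hordV hirrV himV ↦ hBCS V p hp hordV hirrV himV)
      (fun V _ _ _ hsV ↦ X9.bigIm_of_surj V p hp5 hsV) (hIrrK hr1) (hLA hr1)

/-- **Row C16 (`r ≤ 1`: `p = 3` good ordinary, (irr), surj(3) ∨ ram(3)), anomalous or not, with the
anticyclotomic control link PUBLISHED.** Rank `0`: Yan–Zhu Thm. 4.9 (gen 2's
`RowC16.bsdp_rankZero_of_yzThm49`). Rank `1` (`3 ∤ ∏c_ℓ`): Yan–Zhu Thm. 4.9 for the twist + JSW 2017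
Thm. 3.3.1 at `p = 3` (`h331`; JSW's standing `p ≥ 3`) + the typed (IMC≥∘BDP)ᵍ `hLA` (Yan–Zhu
Thm. 4.12 in print) + (irred_K) `hIrrK` + (im) at `3` from surj (Wuthrich L. 20) + cited control;
ram(3) ⇒ surj(3) (`surj_of_irr_of_ram`). Compared with gen 3's `RowC16.bsdp_of_yzThm49_of_onTreeGoodLinks`:
the control binder `hLC` is gone. [cite: YanZhu2024MainConjNonCM, Thm. 4.9, 4.12, 4.15 (§4.6)]
[cite: JetchevSkinnerWan2017, Thm. 3.3.1 with §3.5 (3.5.d)] [cite: Miller2011LMS, Def. 1.1] -/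
theorem RowC16.bsdp_of_yzThm49_of_thm331
    (hGZ : ∀ (N : ℕ) [NeZero N] (W : WeierstrassCurve ℚ) (K : Type) [Field K] [NumberField K],
      gross_zagier N W K)
    (hKo : ∀ (N : ℕ) [NeZero N] (W : WeierstrassCurve ℚ) (K : Type) [Field K] [NumberField K],
      kolyvagin N W K)
    (hB : ∀ (N : ℕ) [NeZero N] (W : WeierstrassCurve ℚ) (K : Type) [Field K] [NumberField K],
      Kolyvagin1990_padicValNat_card_sha_le N W K)
    (hYZ : thm49_charIdeal_eq_padicLFunction_integral)
    (hW20 : Wuthrich2014.lemma20_surjective_threeAdic_of_semistable)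
    (h331 : thm331_anticyclotomicControl)
    (hGr : greenberg_charValue_rankZero) (hGZK : rank_eq_analyticRank_of_analyticRank_le_one)
    (hmod : hasEntireLFunction_rat) (hpar : nonempty_modularParametrizationData)
    (hnf : exists_isNewformOf) (hHL : HoffsteinLuo1997_exists_twist_L_one_ne_zero)
    (hMaz : mazur_not_dvd_maninConstant_of_odd) (hNS : integral_neronScaling_of_isGloballyMinimal)
    (h : RowC16 W p) (hr : W.analyticRank ≤ 1)
    (htam0 : W.analyticRank = 1 → ¬ p ∣ W.tamagawaProduct)
    (hIrrK : W.analyticRank = 1 → ∀ (K : Type) [Field K] [NumberField K], IsImaginaryQuadratic K →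
      SatisfiesHeegnerHypothesis (W.conductorNorm ℤ) K → SatisfiesHeegnerHypothesis p K →
      (W.baseChange K).HasIrreducibleModPGaloisRep p)
    (hLA : W.analyticRank = 1 → ∀ (N : ℕ) [NeZero N] (K : Type) [Field K] [NumberField K]
      (Dt : ModularParametrizationData W N) (H : HeegnerDatum N (NumberField.discr K)) (ιC : K →+* ℂ)
      (P : (W.baseChange K).toAffine.Point),
      W.conductorNorm ℤ = N → IsImaginaryQuadratic K → Odd (NumberField.discr K) →
      NumberField.discr K < -4 → SatisfiesHeegnerHypothesis N K → SatisfiesHeegnerHypothesis p K →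
      (W.quadraticTwist (NumberField.discr K : ℚ)).entireLFunction 1 ≠ 0 →
      WeierstrassCurve.Affine.Point.map ιC.toRatAlgHom P = heegnerPointComplex Dt H →
      ¬ (p : ℤ) ∣ Dt.c → ¬ IsOfFinAddOrder P →
      ∀ (κ : ZpExtension K p), κ.IsAnticyclotomic →
        ∀ (γ : Field.absoluteGaloisGroup K) [Fact (κ.IsTopGenerator γ)] (ι : K →+* ℚ_[p]),
          X11b.IMCLowerWaldspurgerOnTreeGoodAt p κ (X11b.inducedPlace ι) γ ι P) :
    BSDp W p := by
  rcases Nat.lt_or_ge W.analyticRank 1 with h0 | h1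
  · exact RowC16.bsdp_rankZero_of_yzThm49 hYZ hW20 hGr hpar hGZK h (by omega)
  · have hr1 : W.analyticRank = 1 := le_antisymm hr h1
    obtain ⟨hp3, hord, hirr, hsr⟩ := h
    have hsurj : Surj W p := by
      rcases hsr with hs | hram
      · exact hs
      · exact surj_of_irr_of_ram W p hirr hram
    subst hp3
    exact bsdp_rankOne_of_thm331_of_columnMainConjecture_odd hGZ hKo hB h331 hGr hGZK hmod hpar hnf hHL
      hMaz hNS W 3 le_rfl hord hsurj hr1 (htam0 hr1)
      (fun V _ _ hordV hirrV himV ↦ hYZ V 3 le_rfl hordV hirrV himV)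
      (fun V _ _ hordV hsV ↦ X9.bigIm_three_of_surj V hW20 (Or.inl hordV.1) hsV) (hIrrK hr1) (hLA hr1)

/-- **Row C3 at every prime of the row with the anticyclotomic control link PUBLISHED on the whole
ordinary branch (anomalous pairs included).** By cases on `p ∣ a_p`: supersingular — the typed
Kobayashi signed main conjecture (`hKMC`, OPEN in print) + BKO 2024 Cor. A.5 (`hA5`), as in
`RowC3.bsdp_of_mainConjectures_of_onTreeGoodLinks`; ordinary (`htam0 : p ∤ ∏c_ℓ` asked there) — the
column's PUBLISHED cyclotomic MC (BCS (b) `hBCS` for `p > 3` / Yan–Zhu Thm. 4.9 `hYZ` at `p = 3`,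
(im) at `3` by Wuthrich L. 20 `hW20`) + JSW 2017 Thm. 3.3.1 (`h331`) + the typed (IMC≥∘BDP)ᵍ `hLA` +
(irred_K) `hIrrK` (§3); (ram) ⇒ surj from modularity + level lowering (`RowC3.surj`). Compared with
gen 5's `RowC3.bsdp_of_thm511_of_columnMainConjectures`: no `hna`.
[cite: JetchevSkinnerWan2017, Thm. 1.2.1, Thm. 3.3.1 with §3.5 (3.5.d), §7.4.1]
[cite: BurungaleCastellaSkinner2025, Thm. 1.1.2 (b)] [cite: YanZhu2024MainConjNonCM, Thm. 4.9]
[cite: BurungaleKobayashiOta2023, App. A Cor. A.5] [cite: Miller2011LMS, Def. 1.1] -/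
theorem RowC3.bsdp_of_thm331_of_columnMainConjectures
    (hGZ : ∀ (N : ℕ) [NeZero N] (W : WeierstrassCurve ℚ) (K : Type) [Field K] [NumberField K],
      gross_zagier N W K)
    (hKo : ∀ (N : ℕ) [NeZero N] (W : WeierstrassCurve ℚ) (K : Type) [Field K] [NumberField K],
      kolyvagin N W K)
    (hB : ∀ (N : ℕ) [NeZero N] (W : WeierstrassCurve ℚ) (K : Type) [Field K] [NumberField K],
      Kolyvagin1990_padicValNat_card_sha_le N W K)
    (hBCS : thm112b_charIdeal_eq_padicLFunction_integral)
    (hYZ : thm49_charIdeal_eq_padicLFunction_integral)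
    (hW20 : Wuthrich2014.lemma20_surjective_threeAdic_of_semistable)
    (h331 : thm331_anticyclotomicControl) (hA5 : corA5_pPart_of_signedCharIdeal_eq)
    (hGr : greenberg_charValue_rankZero) (hGZK : rank_eq_analyticRank_of_analyticRank_le_one)
    (hmod : hasEntireLFunction_rat) (hpar : nonempty_modularParametrizationData)
    (hnf : exists_isNewformOf) (hLL : diamond1995_refinedSerre)
    (hHL : HoffsteinLuo1997_exists_twist_L_one_ne_zero)
    (hMaz : mazur_not_dvd_maninConstant_of_odd) (hNS : integral_neronScaling_of_isGloballyMinimal)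
    (h : RowC3 W p)
    (htam0 : GoodOrd W p → ¬ p ∣ W.tamagawaProduct)
    (ε : ℤˣ) (hKMC : (p : ℤ) ∣ W.frobeniusTrace p → Supersingular.KobayashiMainConjecture W p ε)
    (hIrrK : GoodOrd W p → ∀ (K : Type) [Field K] [NumberField K], IsImaginaryQuadratic K →
      SatisfiesHeegnerHypothesis (W.conductorNorm ℤ) K → SatisfiesHeegnerHypothesis p K →
      (W.baseChange K).HasIrreducibleModPGaloisRep p)
    (hLA : GoodOrd W p → ∀ (N : ℕ) [NeZero N] (K : Type) [Field K] [NumberField K]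
      (Dt : ModularParametrizationData W N) (H : HeegnerDatum N (NumberField.discr K)) (ιC : K →+* ℂ)
      (P : (W.baseChange K).toAffine.Point),
      W.conductorNorm ℤ = N → IsImaginaryQuadratic K → Odd (NumberField.discr K) →
      NumberField.discr K < -4 → SatisfiesHeegnerHypothesis N K → SatisfiesHeegnerHypothesis p K →
      (W.quadraticTwist (NumberField.discr K : ℚ)).entireLFunction 1 ≠ 0 →
      WeierstrassCurve.Affine.Point.map ιC.toRatAlgHom P = heegnerPointComplex Dt H →
      ¬ (p : ℤ) ∣ Dt.c → ¬ IsOfFinAddOrder P →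
      ∀ (κ : ZpExtension K p), κ.IsAnticyclotomic →
        ∀ (γ : Field.absoluteGaloisGroup K) [Fact (κ.IsTopGenerator γ)] (ι : K →+* ℚ_[p]),
          X11b.IMCLowerWaldspurgerOnTreeGoodAt p κ (X11b.inducedPlace ι) γ ι P) :
    BSDp W p := by
  by_cases hdvd : (p : ℤ) ∣ W.frobeniusTrace p
  · -- supersingular: typed Kobayashi MC (one sign) + BKO Cor. A.5
    exact RowC3.bsdp_rankOne_ss_of_kobayashiMainConjecture_of_corA5 hA5 hmod hGZK h hdvd ε (hKMC hdvd)
  · -- ordinary (anomalous allowed): published column MC + published control + typed IMC∘BDP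
    have hord : GoodOrd W p := ⟨h.2.2.1, hdvd⟩
    have hp : 5 ≤ p ∨ p = 3 ∧ (GoodOrd W p ∨ W.frobeniusTrace 3 = 0) := h.2.2.2.2
    have hp3 : 3 ≤ p := by rcases hp with h5 | ⟨h3, -⟩ <;> omega
    refine bsdp_rankOne_of_thm331_of_columnMainConjecture_odd hGZ hKo hB h331 hGr hGZK hmod hpar hnf hHL
      hMaz hNS W p hp3 hord (RowC3.surj hnf hLL h) h.1 (htam0 hord) ?_ ?_ (hIrrK hord) (hLA hord)
    · intro V _ _ hordV hirrV himV
      by_cases h5 : 5 ≤ p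
      · exact hBCS V p (by omega) hordV hirrV himV
      · have h3 : p = 3 := by rcases hp with h | ⟨h, -⟩ <;> omega
        subst h3
        exact hYZ V 3 le_rfl hordV hirrV himV
    · intro V _ _ hordV hsV
      by_cases h5 : 5 ≤ p
      · exact X9.bigIm_of_surj V p h5 hsV
      · have h3 : p = 3 := by rcases hp with h | ⟨h, -⟩ <;> omega
        subst h3
        exact X9.bigIm_three_of_surj V hW20 (Or.inl hordV.1) hsV

end Rows

end Summit.BirchSwinnertonDyer.Rank1Residual

end
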